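import Summits.QuantumFields.YangMills.Theorems.BalabanLadderUVSeamRecClassicalResponseGlue
import Summits.QuantumFields.YangMills.Theorems.SoloBlindSinglePlaquette
import Summits.QuantumFields.YangMills.Theorems.LangevinControlUVOSLegsFromFemtoAndGapStubCollar
import HarnessLib

/-!
# Crux `UVSeamRec` (stmt-QuantumFields-20043), line `coldwall_pure`: the classical carriers of separated cubes are dominated by the cost of
# ONE set of torus plaquettes (classical bound + torus geometry for the fixed-scale rung of `stub_gaussianDomination`)

Helper file (`--supports stmt-QuantumFields-20043`) of the LEAD seat `ym-spine-20043-p1` (gen 17); consumed by the sequel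
`…CarrierExpMomentFixedScale` (the fixed-scale (EM_Q) rung).  Three elementary facts, every compact `G`:
* §1 CLASSICAL: the torus (or any) configuration restricted to a cube is an extension of its own exterior, so the Dirichlet ground energy is at
  most the cube's boundary Wilson action: `m₀(η) ≤ S_cube(η)` (`tiltedMin_zero_le_wilsonBoundaryAction`), hence
  `classicalResponse ≤ S_cube` (`classicalResponse_le_wilsonBoundaryAction`, via `classicalResponse_le_tiltedMin_zero`) and
  `carrierCl C 1 β R ≤ (βR⁴/C)·S_cube` (`carrierCl_le_mul_wilsonBoundaryAction`).
* §2 GEOMETRY: plaquettes touching the cube of side `2R+3` centred at `x` have base points in `x + [−(R+2), R+1]⁴` (at most `6(2R+4)⁴` of them);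
  for a cyclically `2R+4`-separated family on the odd torus `(ℤ/(2L+1))⁴`, `4R+8 ≤ L`, the map `(i, p) ↦ (p.1 mod 2L+1, p.2)` is injective on
  the disjoint union of these plaquette sets (`torusPlaq_injOn_centred`, `torusPlaq_ne_of_separated`, `injOn_sigma_torusPlaq`).
* §3 LIFT: the boundary actions of the cubes, read on the periodic lift of a torus configuration, sum to the total cost of that ONE image set of
  torus plaquettes (`sum_wilsonBoundaryAction_torusLift_eq`, `card_image_sigma_torusPlaq_le`) — the shape the odd-torus chessboard estimate eats.

HONEST FRAMING: bookkeeping (gluing, cube geometry, periodic lift); nothing of E0′, NT or the gap; YM mass gap NOT proved; not Clay.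

References: Seiler, LNP 159 (1982) Ch. 2 (DLR kernels of the Wilson action); Georgii (2011) §1.2 (gluing).
-/

open MeasureTheory Finset
open Literature.MathematicalPhysics.QuantumFieldTheory (GaugeConfig LatticeRep Plaquette)
open Literature.MathematicalPhysics.QuantumLattice (LGConfig ZdPlaquette ZdEdge plaquettesTouching plaquetteEdges mem_plaquettesTouching_iff
  wilsonBoundaryAction plaquetteObs torusLift plaquetteHolonomyZd injOn_torusProj_of_near)
open Literature.MathematicalPhysics.QuantumLattice.FreeEnergy (plaquetteHolonomyZd_torusLift)
open Literature.Probability.LatticeModels (glueWith Torus.proj Torus.proj_apply)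
open Summit.QuantumFields.YangMills.Cruxes.OSLegsFromFemtoAndGap.DlrCollarTransfer
open Summit.QuantumFields.YangMills.Theorems.SoloBlind (plaquetteCost)

noncomputable section

namespace Summit.QuantumFields.YangMills.Cruxes.UVSeamRec.ClassicalResponse

/-! ### §1 Classical: the response is at most the cube's boundary action of ANY extension, in particular of the configuration itself -/

section Classical

variable {G : Type} [Group G] [TopologicalSpace G] [IsTopologicalGroup G] [CompactSpace G]
  [MeasurableSpace G] [BorelSpace G] (r : LatticeRep G)

/-- Gluing a configuration's own restriction back gives the configuration. [folklore: Georgii (2011) §1.2] -/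
theorem glueWith_restrict_eq {V S : Type*} (Λ : Finset V) (η : V → S) : glueWith Λ (fun e : Λ => η e) η = η := by
  funext v
  unfold glueWith
  split_ifs <;> rfl

omit [BorelSpace G] in
/-- **The Dirichlet ground energy is at most the boundary action of the exterior's own configuration**:
`m₀(η) ≤ S_cube(η)` (`η` restricted to the cube is one competitor). [folklore] -/
theorem tiltedMin_zero_le_wilsonBoundaryAction (c : Fin 4 → ℤ) (b : ℕ) (q : Fin 4 × Fin 4) (x : Fin 4 → ℤ)
    (η : LGConfig 4 G) : tiltedMin r c b q x 0 η ≤ wilsonBoundaryAction r.ρ (cubeEdges c b) η := by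
  have h := tiltedMin_le (r := r) c b q x 0 η (fun e => η e)
  rw [tiltedAction_zero, glueWith_restrict_eq] at h
  exact h

omit [BorelSpace G] in
/-- **The classical response of the centred cube is at most its boundary action**: for `0 < s ≤ 1`, `q.1 < q.2`,
`classicalResponse_{x−(R+1), 2R+3}(q, x; s; η) ≤ S_cube(η)`. [folklore] -/
theorem classicalResponse_le_wilsonBoundaryAction (q : Fin 4 × Fin 4) (hq : q.1 < q.2) (x : Fin 4 → ℤ) (R : ℕ) {s : ℝ}
    (hs : 0 < s) (hs1 : s ≤ 1) (η : LGConfig 4 G) :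
    classicalResponse r (fun k => x k - (R + 1)) (2 * R + 3) q x s η ≤
      wilsonBoundaryAction r.ρ (cubeEdges (fun k => x k - (R + 1)) (2 * R + 3)) η :=
  (classicalResponse_le_tiltedMin_zero (r := r) q hq (by rw [depth_centred]; omega) hs hs1 η).trans
    (tiltedMin_zero_le_wilsonBoundaryAction r _ _ q x η)

omit [BorelSpace G] in
/-- **The classical carrier is at most `(βR⁴/C)` times the cube's boundary action.** [folklore] -/
theorem carrierCl_le_mul_wilsonBoundaryAction {C β : ℝ} (hC : 0 < C) (hβ : 0 ≤ β) (R : ℕ) (q : Fin 4 × Fin 4) (hq : q.1 < q.2)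
    (x : Fin 4 → ℤ) (η : LGConfig 4 G) :
    carrierCl r C 1 β R q x η ≤
      β * (R : ℝ) ^ 4 / C * wilsonBoundaryAction r.ρ (cubeEdges (fun k => x k - (R + 1)) (2 * R + 3)) η := by
  unfold carrierCl
  exact mul_le_mul_of_nonneg_left (classicalResponse_le_wilsonBoundaryAction r q hq x R one_pos le_rfl η) (by positivity)

end Classical

/-! ### §2 Geometry: the plaquettes touching separated centred cubes project injectively to the odd torus -/

section Geometry

/-- Base points of plaquettes touching the cube of side `2R+3` centred at `x` lie in `x + [−(R+2), R+1]⁴`. [folklore] -/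
theorem base_sub_mem_of_mem_plaquettesTouching_centred {x : Fin 4 → ℤ} {R : ℕ} {p : ZdPlaquette 4}
    (hp : p ∈ plaquettesTouching (cubeEdges (fun k => x k - (R + 1)) (2 * R + 3))) (k : Fin 4) :
    -((R : ℤ) + 2) ≤ p.1 k - x k ∧ p.1 k - x k ≤ (R : ℤ) + 1 := by
  obtain ⟨e, he⟩ := mem_plaquettesTouching_iff.1 hp
  rw [Finset.mem_inter] at he
  have hcube := near_of_mem_cubeSites_centred (fst_mem_cubeSites_of_mem_cubeEdges he.2) k
  have key : 0 ≤ e.1 k - p.1 k ∧ e.1 k - p.1 k ≤ 1 := by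
    have he1 := he.1
    simp only [plaquetteEdges, Finset.mem_insert, Finset.mem_singleton] at he1
    rcases he1 with rfl | rfl | rfl | rfl <;> simp [Pi.single_apply] <;> split_ifs <;> simp
  rw [abs_le] at hcube
  constructor <;> linarith [key.1, key.2, hcube.1, hcube.2]

/-- A crude count: at most `6(2R+4)⁴` plaquettes touch the centred cube of side `2R+3`. [folklore] -/
theorem card_plaquettesTouching_centred_le (x : Fin 4 → ℤ) (R : ℕ) :
    #(plaquettesTouching (cubeEdges (fun k => x k - (R + 1)) (2 * R + 3))) ≤ 6 * (2 * R + 4) ^ 4 := by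
  classical
  have hsub : plaquettesTouching (cubeEdges (fun k => x k - (R + 1)) (2 * R + 3)) ⊆
      (Fintype.piFinset fun k : Fin 4 => Finset.Icc (x k - ((R : ℤ) + 2)) (x k + ((R : ℤ) + 1))) ×ˢ
        (univ : Finset {p : Fin 4 × Fin 4 // p.1 < p.2}) := by
    intro p hp
    rw [mem_product]
    refine ⟨Fintype.mem_piFinset.2 fun k => ?_, mem_univ _⟩
    have hb := base_sub_mem_of_mem_plaquettesTouching_centred hp k
    rw [Finset.mem_Icc]
    constructor <;> linarith [hb.1, hb.2]
  refine (card_le_card hsub).trans ?_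
  rw [card_product, Fintype.card_piFinset, card_univ, show Fintype.card {p : Fin 4 × Fin 4 // p.1 < p.2} = 6 by decide]
  have h : ∀ k : Fin 4, #(Finset.Icc (x k - ((R : ℤ) + 2)) (x k + ((R : ℤ) + 1))) = 2 * R + 4 := by
    intro k
    rw [Int.card_Icc]
    have : x k + ((R : ℤ) + 1) + 1 - (x k - ((R : ℤ) + 2)) = ((2 * R + 4 : ℕ) : ℤ) := by push_cast; ring
    rw [this, Int.toNat_natCast]
  simp only [h, prod_const, card_univ, Fintype.card_fin]
  omega

/-- **Separated cubes do not share torus plaquettes.**  If `x` and `x'` are cyclically `2R+4`-separated in some coordinate (mod `2L+1`),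
then a plaquette touching the cube centred at `x` and one touching the cube centred at `x'` have distinct images on the torus
`(ℤ/(2L+1))⁴` (base points differ by at most `2R+3` in that coordinate modulo the separation). [folklore] -/
theorem torusPlaq_ne_of_separated {L R : ℕ} {x x' : Fin 4 → ℤ}
    (hsep : ∃ k : Fin 4, (2 * (R : ℤ) + 4) ≤ |((((x k - x' k : ℤ) : ZMod (2 * L + 1))).valMinAbs : ℤ)|)
    {p p' : ZdPlaquette 4} (hp : p ∈ plaquettesTouching (cubeEdges (fun k => x k - (R + 1)) (2 * R + 3)))
    (hp' : p' ∈ plaquettesTouching (cubeEdges (fun k => x' k - (R + 1)) (2 * R + 3))) :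
    ((Torus.proj (2 * L + 1) p.1, p.2) : Plaquette 4 (2 * L + 1)) ≠ (Torus.proj (2 * L + 1) p'.1, p'.2) := by
  obtain ⟨k, hk⟩ := hsep
  intro h
  have h1 : ((p.1 k : ℤ) : ZMod (2 * L + 1)) = ((p'.1 k : ℤ) : ZMod (2 * L + 1)) := by
    have := congr_fun (congrArg Prod.fst h) k
    simpa [Torus.proj_apply] using this
  have h2 : (((x k - x' k : ℤ)) : ZMod (2 * L + 1)) = ((((x k - p.1 k) + (p'.1 k - x' k) : ℤ)) : ZMod (2 * L + 1)) := by
    push_cast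
    rw [h1]
    ring
  rw [h2] at hk
  have h3 := Literature.MathematicalPhysics.QuantumLattice.abs_valMinAbs_intCast_le (2 * L + 1) ((x k - p.1 k) + (p'.1 k - x' k))
  have hb := base_sub_mem_of_mem_plaquettesTouching_centred hp k
  have hb' := base_sub_mem_of_mem_plaquettesTouching_centred hp' k
  have h4 : |(x k - p.1 k) + (p'.1 k - x' k)| ≤ 2 * (R : ℤ) + 3 := by
    rw [abs_le]
    constructor <;> linarith [hb.1, hb.2, hb'.1, hb'.2]
  linarith

/-- **Within one centred cube the torus projection of touching plaquettes is injective** (`4R+8 ≤ L`). [folklore] -/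
theorem torusPlaq_injOn_centred {L R : ℕ} (hRL : 4 * R + 8 ≤ L) (x : Fin 4 → ℤ) :
    Set.InjOn (fun p : ZdPlaquette 4 => ((Torus.proj (2 * L + 1) p.1, p.2) : Plaquette 4 (2 * L + 1)))
      ↑(plaquettesTouching (cubeEdges (fun k => x k - (R + 1)) (2 * R + 3))) := by
  intro p hp p' hp' h
  have hinj := injOn_torusProj_of_near (M := 2 * L + 1) x (ϱ := (R : ℤ) + 2) (by push_cast; omega)
  have hn : ∀ {p : ZdPlaquette 4}, p ∈ plaquettesTouching (cubeEdges (fun k => x k - (R + 1)) (2 * R + 3)) →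
      ∀ j, |p.1 j - x j| ≤ (R : ℤ) + 2 := by
    intro p hp j
    have hb := base_sub_mem_of_mem_plaquettesTouching_centred hp j
    rw [abs_le]
    constructor <;> linarith [hb.1, hb.2]
  have h' : ((Torus.proj (2 * L + 1) p.1, p.2) : Plaquette 4 (2 * L + 1)) = (Torus.proj (2 * L + 1) p'.1, p'.2) := h
  obtain ⟨h1', h2'⟩ := Prod.mk.inj h'
  have h1 : p.1 = p'.1 := hinj (hn (Finset.mem_coe.1 hp)) (hn (Finset.mem_coe.1 hp')) h1'
  exact Prod.ext h1 h2'

/-- **Injectivity over a separated family**: on the disjoint union over `i ∈ T` of the plaquettes touching the cube centred at `x i`, the map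
`(i, p) ↦ (p.1 mod 2L+1, p.2)` is injective. [folklore] -/
theorem injOn_sigma_torusPlaq {L R n : ℕ} (hRL : 4 * R + 8 ≤ L) (x : Fin n → (Fin 4 → ℤ))
    (hsep : ∀ i j : Fin n, i ≠ j → ∃ k : Fin 4,
      (2 * (R : ℤ) + 4) ≤ |((((x i k - x j k : ℤ) : ZMod (2 * L + 1))).valMinAbs : ℤ)|)
    (T : Finset (Fin n)) :
    Set.InjOn (fun ip : (Σ _ : Fin n, ZdPlaquette 4) => ((Torus.proj (2 * L + 1) ip.2.1, ip.2.2) : Plaquette 4 (2 * L + 1)))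
      ↑(T.sigma fun i => plaquettesTouching (cubeEdges (fun k => x i k - (R + 1)) (2 * R + 3))) := by
  rintro ⟨i, p⟩ hip ⟨j, p'⟩ hjp h
  rw [Finset.mem_coe, Finset.mem_sigma] at hip hjp
  by_cases hij : i = j
  · subst hij
    have hpp : p = p' := torusPlaq_injOn_centred hRL (x i) (Finset.mem_coe.2 hip.2) (Finset.mem_coe.2 hjp.2) h
    rw [hpp]
  · exact absurd h (torusPlaq_ne_of_separated (hsep i j hij) hip.2 hjp.2)

end Geometry

/-! ### §3 The boundary actions of the cubes, read on the periodic lift, are the cost of one set of torus plaquettes -/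

section Lift

variable {G : Type} [Group G] {N : ℕ} (ρ : G →* Matrix (Fin N) (Fin N) ℂ)

/-- The boundary Wilson action on the periodic lift is a sum of torus plaquette costs. [folklore] -/
theorem wilsonBoundaryAction_torusLift_eq_sum (Λ : Finset (ZdEdge 4)) (M : ℕ) (U : GaugeConfig 4 M G) :
    wilsonBoundaryAction ρ Λ (torusLift M U) =
      ∑ p ∈ plaquettesTouching Λ, plaquetteCost ρ (Torus.proj M p.1) p.2.1.1 p.2.1.2 U := by
  unfold wilsonBoundaryAction plaquetteCost plaquetteObs
  refine Finset.sum_congr rfl fun p _ => ?_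
  rw [plaquetteHolonomyZd_torusLift]

/-- **One set of torus plaquettes**: for a cyclically `2R+4`-separated family, `4R+8 ≤ L`, the sum over `i ∈ T` of the boundary actions of the
cubes centred at `x i`, read on the periodic lift of a torus configuration, is the total cost of the (injective) image set of torus plaquettes.
[folklore] -/
theorem sum_wilsonBoundaryAction_torusLift_eq {L R n : ℕ} (hRL : 4 * R + 8 ≤ L) (x : Fin n → (Fin 4 → ℤ))
    (hsep : ∀ i j : Fin n, i ≠ j → ∃ k : Fin 4,
      (2 * (R : ℤ) + 4) ≤ |((((x i k - x j k : ℤ) : ZMod (2 * L + 1))).valMinAbs : ℤ)|)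
    (T : Finset (Fin n)) (U : GaugeConfig 4 (2 * L + 1) G) :
    ∑ i ∈ T, wilsonBoundaryAction ρ (cubeEdges (fun k => x i k - (R + 1)) (2 * R + 3)) (torusLift (2 * L + 1) U) =
      ∑ p ∈ (T.sigma fun i => plaquettesTouching (cubeEdges (fun k => x i k - (R + 1)) (2 * R + 3))).image
          (fun ip : (Σ _ : Fin n, ZdPlaquette 4) => ((Torus.proj (2 * L + 1) ip.2.1, ip.2.2) : Plaquette 4 (2 * L + 1))),
        plaquetteCost ρ p.1 p.2.1.1 p.2.1.2 U := by
  classical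
  rw [Finset.sum_image (injOn_sigma_torusPlaq hRL x hsep T), Finset.sum_sigma]
  refine Finset.sum_congr rfl fun i _ => ?_
  rw [wilsonBoundaryAction_torusLift_eq_sum]

/-- The image set has at most `6(2R+4)⁴·#T` plaquettes. [folklore] -/
theorem card_image_sigma_torusPlaq_le {L R n : ℕ} (x : Fin n → (Fin 4 → ℤ)) (T : Finset (Fin n)) :
    #((T.sigma fun i => plaquettesTouching (cubeEdges (fun k => x i k - (R + 1)) (2 * R + 3))).image
        (fun ip : (Σ _ : Fin n, ZdPlaquette 4) => ((Torus.proj (2 * L + 1) ip.2.1, ip.2.2) : Plaquette 4 (2 * L + 1)))) ≤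
      6 * (2 * R + 4) ^ 4 * #T := by
  classical
  refine card_image_le.trans ?_
  rw [card_sigma]
  calc ∑ i ∈ T, #(plaquettesTouching (cubeEdges (fun k => x i k - (R + 1)) (2 * R + 3)))
      ≤ ∑ _i ∈ T, 6 * (2 * R + 4) ^ 4 := sum_le_sum fun i _ => card_plaquettesTouching_centred_le (x i) R
    _ = 6 * (2 * R + 4) ^ 4 * #T := by rw [sum_const, smul_eq_mul]; ring

end Lift

end Summit.QuantumFields.YangMills.Cruxes.UVSeamRec.ClassicalResponse

end
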